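import Summits.ValiantsHypothesis.ValiantsHypothesis.Theorems.KPlusLogSqLawOctaveWitness
import Summits.ValiantsHypothesis.ValiantsHypothesis.Theorems.KPlusLogSqLawTropicalBPadding
import Summits.ValiantsHypothesis.ValiantsHypothesis.Theorems.KPlusLogSqLawOctaveReducedForm
import Summits.ValiantsHypothesis.ValiantsHypothesis.Theorems.KPlusLogSqLawOctaveNormEra
import Summits.ValiantsHypothesis.ValiantsHypothesis.Theorems.KPlusLogSqLawOctaveCondPerturb
import Summits.ValiantsHypothesis.ValiantsHypothesis.Theorems.KPlusLogSqLawOctaveTemperedGlue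

/-!
# Route «KPlusLogSqLaw», octave door — line «conditioning»: the octave-stability statement K1 and its kernel-checked corollaries (Ω-W ⟺ K1 through the landed rungs R0 · R1 · R2)

HONEST FRAMING.  Prover seat val-width-19561-r1 (g1), `--supports stmt-ValiantsHypothesis-19561` (crux `WeakLifting`, OPEN), line
«conditioning» of ideator val-idea-1 (g3) (`Cruxes/WeakLifting/Lines/conditioning.lean` v4, critic verdict #22 PASS-WITH-PRICE).  `OctaveStability`
(the line's law stub K1) is DEFINED below, NOT asserted; `OctaveWeakLifting` (Ω-W, stmt-ValiantsHypothesis-24457), `WeakLifting` (stmt-19561),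
`TropicalB` (stmt-19771) and Conjecture B stay OPEN and untouched; VP ≠ VNP is not moved.  This file is the by-name corollary file of the line:
everything is composition of LANDED theorems, and the only content-bearing input of each corollary is its explicit hypothesis.

THE THREE LANDED RUNGS (cited by name, all in namespace `…Theorems.KPlusLogSqLaw.Octave`):
* R0 `reducedForm` (`…OctaveReducedForm`, p599889): same determinant after merging equal exponents / dropping zero letters; injective exponents,
  `K' ≤ K` symmetric letters, positive entry scales `ρ_l = max |entries|`.
* R1 `normEra_octaveBound` (`…OctaveNormEra`, p599913): distinct exponents + `2^W`-conditioned letters (sup-norm certificates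
  `a‖v‖ ≤ ‖S_l v‖ ≤ 2^W a‖v‖`) ⇒ `octaveCount (det F) ≤ (2(W + ⌊log₂ K⌋ + 1) + 2)·K²` — no tropical hypothesis, no symmetry.
* R2 `conditionedPerturbation` (`…OctaveCondPerturb`, p599938): a symmetric letter tuple with entry scales has a symmetric perturbation of
  entrywise relative size `2^{-P}` whose letters are `2^{m(P + ⌊log₂ m⌋ + 8)}`-conditioned and whose pencil determinant is nonzero.

CONTENT (0 sorry).
* `OctaveStability` — K1, DEFINED NOT asserted: under the TropRow hypothesis of Ω-W at `(m, K, n)`, a symmetric perturbation of a symmetric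
  pencil with injective exponents and entry scales, at entrywise relative precision `2^{-2^{C(K+⌊log₂m⌋²)}(n+1)}` and with nonzero determinant,
  retains all but `2^{C(K+⌊log₂m⌋²)}(n+1)` root octaves up to the factor `3`.
* `octaveWeakLifting_of_octaveStability : OctaveStability → OctaveWeakLifting` — THE COMPOSITION R0 → R2 → K1 → R1 with `C ↦ C + 12`
  (`condBudget_arith`), the class padding `tropRootLawAt_of_le_classes` moving the TropRow hypothesis from `K` to the reduced `K' ≤ K`.
* `valiant_of_tropicalB_of_octaveStability : TropicalB → OctaveStability → VP ≠ VNP` (landed glue `valiant_of_tropicalB_of_octaveWeakLifting`).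
* `octaveStability_of_octaveWeakLifting` (the converse is trivial and `S'`-blind — critic #22) and `octaveStability_iff_octaveWeakLifting`:
  as STATEMENTS K1 ≡ Ω-W; the line re-types the door in perturbation form, it does not weaken it.
* dictionary with the other doors of record: `octaveStability_of_weakLifting` (W, stmt-19561 ⇒ K1), `octaveStability_of_temperedRepresentability` /
  `octaveStability_of_freeTemperedRepresentability` (the tempered-representability candidates of `…OctaveTemperedGlue` ⇒ K1).
The route decl `Theses.KPlusLogSqLawOctave.OctaveWeakLifting` is `Iff.rfl`-equal to `OctaveWeakLifting` here (`octaveWeakLifting_iff_glueShape`,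
`…OctaveGlueCoherence`), so a proof of `OctaveStability` would close stmt-24457 by `octaveWeakLifting_of_octaveStability` verbatim.
-/

set_option linter.dupNamespace false -- single-conjunct summit: the namespace `ValiantsHypothesis.ValiantsHypothesis` repeats a component (D-0017)
set_option autoImplicit false

namespace Summit.ValiantsHypothesis.ValiantsHypothesis.Theorems.KPlusLogSqLaw.Octave

open Polynomial Finset Matrix
open scoped BigOperators
open Summit.ValiantsHypothesis.ValiantsHypothesis.Theorems.LacunarySymmetroidMatrixDescartes.TropicalCensus (TropRootLawAt)
open Summit.ValiantsHypothesis.ValiantsHypothesis.Theorems.KPlusLogSqLaw (tropRootLawAt_of_le_classes)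
open Summit.ValiantsHypothesis.ValiantsHypothesis.Theses.KPlusLogSqLaw (TropicalB WeakLifting)

section Conditioning

/-- **K1 · octave stability** (the law stub of line «conditioning»; DEFINED, NOT asserted; Ω-W-equivalent, see
`octaveStability_iff_octaveWeakLifting`): under the TropRow hypothesis of Ω-W at `(m, K, n)`, every symmetric perturbation `S'` of a
symmetric `(m, K)` pencil `S` with injective exponents and entry scales `ρ_l` (all entries of `S_l` of modulus `≤ ρ_l`, one of modulus
`≥ ρ_l`), at entrywise precision `2^{2^{C(K+⌊log₂m⌋²)}(n+1)}·|S' − S| ≤ ρ` and with `pencilDet d S' ≠ 0`, satisfies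
`Ω(det S) ≤ 2^{C(K+⌊log₂m⌋²)}(n+1) + 3·Ω(det S')`.  Why it might fail: octaves whose sign changes are all `2^{-P}`-deep (a near-tangential pair
of roots alone in its octave) are destroyed by perturbation; the statement says TropRow bounds the number of such octaves — a family of
budget-many isolated near-double roots would refute it, and would already refute Ω-W.  Stated (as stub K1 `stub_octaveStability`, with the
entry-scale certificate abbreviated `IsEntryScale`) in `Cruxes/WeakLifting/Lines/conditioning.lean` v4 of stmt-ValiantsHypothesis-19561; tagged
`@[conjecture]`: an open obligation node of our theories, provable / refutable by name, not a vendored fact. [conjecture of line «conditioning», val-idea-1 g3] -/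
@[conjecture] def OctaveStability : Prop :=
  ∃ C : ℕ, ∀ (m K n : ℕ), TropRootLawAt m K n →
    ∀ (d : Fin K → ℕ) (S S' : Fin K → Matrix (Fin m) (Fin m) ℝ) (ρ : Fin K → ℝ), Function.Injective d →
      (∀ l, (S l).IsSymm) → (∀ l, (S' l).IsSymm) → (∀ l, 0 < ρ l) → (∀ l, (∀ i j, |S l i j| ≤ ρ l) ∧ ∃ i j, ρ l ≤ |S l i j|) →
      (∀ l i j, (2 : ℝ) ^ (2 ^ (C * (K + Nat.log 2 m ^ 2)) * (n + 1)) * |S' l i j - S l i j| ≤ ρ l) →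
      pencilDet d S' ≠ 0 →
      octaveCount (pencilDet d S) ≤ 2 ^ (C * (K + Nat.log 2 m ^ 2)) * (n + 1) + 3 * octaveCount (pencilDet d S')

/-- the inner step of the budget arithmetic: `2(m(Q + L + 8) + K + 1) + 2 ≤ Q·(2m(L + 9) + 2K + 4)` for `Q ≥ 1`. [folklore] -/
theorem condBudget_inner_le (m L K Q : ℕ) (hQ : 1 ≤ Q) :
    2 * (m * (Q + L + 8) + K + 1) + 2 ≤ Q * (2 * (m * (L + 9)) + 2 * K + 4) := by
  obtain ⟨q, rfl⟩ := Nat.exists_eq_add_of_le hQ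
  nlinarith [Nat.zero_le (q * m * L), Nat.zero_le (q * m), Nat.zero_le (q * K), Nat.zero_le q]

/-- **the budget arithmetic of the composition**: with `L = ⌊log₂ m⌋`, `1 ≤ K' ≤ K` and `P = 2^{C(K'+L²)}(n+1)`,
`P + 3·(2(m(P + L + 8) + ⌊log₂ K'⌋ + 1) + 2)·K'² ≤ 2^{(C+12)(K+L²)}(n+1)`. [folklore] -/
theorem condBudget_arith (C m K K' n : ℕ) (hK' : K' ≤ K) (hK0 : 0 < K') :
    2 ^ (C * (K' + Nat.log 2 m ^ 2)) * (n + 1) +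
        3 * ((2 * (m * (2 ^ (C * (K' + Nat.log 2 m ^ 2)) * (n + 1) + Nat.log 2 m + 8) + Nat.log 2 K' + 1) + 2) * (K' * K')) ≤
      2 ^ ((C + 12) * (K + Nat.log 2 m ^ 2)) * (n + 1) := by
  set L := Nat.log 2 m with hL
  set Q := 2 ^ (C * (K + L ^ 2)) * (n + 1) with hQ
  set P := 2 ^ (C * (K' + L ^ 2)) * (n + 1) with hP
  have hPQ : P ≤ Q :=
    Nat.mul_le_mul_right _ (Nat.pow_le_pow_right (by norm_num) (Nat.mul_le_mul_left _ (by omega)))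
  have hQ1 : 1 ≤ Q := by
    have : 1 ≤ 2 ^ (C * (K + L ^ 2)) := Nat.one_le_two_pow
    rw [hQ]; nlinarith
  have hm : m < 2 ^ (L + 1) := Nat.lt_pow_succ_log_self one_lt_two m
  have hKK : Nat.log 2 K' ≤ K := (Nat.log_le_self 2 K').trans hK'
  have hxK : K < 2 ^ K := Nat.lt_two_pow_self
  set x := 2 ^ K with hx
  set y := 2 ^ L with hy
  have hy1 : 1 ≤ y := Nat.one_le_two_pow
  have hx1 : 1 ≤ x := Nat.one_le_two_pow
  have hm' : m ≤ 2 * y := by rw [hy]; rw [pow_succ] at hm; omega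
  have hLy : L < y := by rw [hy]; exact Nat.lt_two_pow_self
  -- polynomial bound on the bracket
  have hbr : 1 + 3 * ((2 * (m * (L + 9)) + 2 * K + 4) * (K' * K')) ≤ 2 ^ 9 * (x * x * x) * (y * y) := by
    have hK'x : K' ≤ x := by omega
    have h1 : K' * K' ≤ x * x := Nat.mul_le_mul hK'x hK'x
    have h2 : m * (L + 9) ≤ 2 * y * (10 * y) := Nat.mul_le_mul hm' (by omega)
    have e1 : 2 * (m * (L + 9)) + 2 * K + 4 ≤ 40 * (y * y) + 6 * x := by nlinarith [h2]
    have e2 : (2 * (m * (L + 9)) + 2 * K + 4) * (K' * K') ≤ (40 * (y * y) + 6 * x) * (x * x) :=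
      Nat.mul_le_mul e1 h1
    have p1 : 1 ≤ x * x * x * (y * y) := by
      have := Nat.mul_le_mul (Nat.mul_le_mul (Nat.mul_le_mul hx1 hx1) hx1) (Nat.mul_le_mul hy1 hy1); simpa using this
    have p2 : x * x * (y * y) ≤ x * x * x * (y * y) := by
      have := Nat.mul_le_mul_right (y * y) (Nat.mul_le_mul_left (x * x) hx1); simpa [mul_comm, mul_assoc, mul_left_comm] using this
    have p3 : x * x * x ≤ x * x * x * (y * y) := by
      have := Nat.mul_le_mul_left (x * x * x) (Nat.mul_le_mul hy1 hy1); simpa using this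
    nlinarith [e2, p1, p2, p3]
  -- exponent bookkeeping
  have hpow : 2 ^ 9 * (x * x * x) * (y * y) * Q ≤ 2 ^ ((C + 12) * (K + L ^ 2)) * (n + 1) := by
    have hL2 : L ≤ L ^ 2 := by rw [sq]; exact Nat.le_mul_self L
    have hK1 : 1 ≤ K := hK0.trans_le hK'
    have : 2 ^ 9 * (x * x * x) * (y * y) * 2 ^ (C * (K + L ^ 2)) ≤ 2 ^ ((C + 12) * (K + L ^ 2)) := by
      rw [hx, hy, ← pow_add, ← pow_add, ← pow_add, ← pow_add, ← pow_add, ← pow_add]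
      exact Nat.pow_le_pow_right (by norm_num) (by nlinarith)
    calc 2 ^ 9 * (x * x * x) * (y * y) * Q = 2 ^ 9 * (x * x * x) * (y * y) * 2 ^ (C * (K + L ^ 2)) * (n + 1) := by rw [hQ]; ring
      _ ≤ 2 ^ ((C + 12) * (K + L ^ 2)) * (n + 1) := Nat.mul_le_mul_right _ this
  calc P + 3 * ((2 * (m * (P + L + 8) + Nat.log 2 K' + 1) + 2) * (K' * K'))
      ≤ Q + 3 * ((2 * (m * (Q + L + 8) + K + 1) + 2) * (K' * K')) := by gcongr
    _ ≤ Q + 3 * ((Q * (2 * (m * (L + 9)) + 2 * K + 4)) * (K' * K')) := by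
        have := condBudget_inner_le m L K Q hQ1
        gcongr
    _ = Q * (1 + 3 * ((2 * (m * (L + 9)) + 2 * K + 4) * (K' * K'))) := by ring
    _ ≤ Q * (2 ^ 9 * (x * x * x) * (y * y)) := Nat.mul_le_mul_left _ hbr
    _ = 2 ^ 9 * (x * x * x) * (y * y) * Q := by ring
    _ ≤ 2 ^ ((C + 12) * (K + L ^ 2)) * (n + 1) := hpow

/-- **Ω-W ⟸ K1 — THE COMPOSITION R0 → R2 → K1 → R1 (kernel-checked, `C ↦ C + 12`).**  Given the TropRow hypothesis at `(m, K, n)` and a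
symmetric `(m, K)` pencil: reduce it (R0: same determinant, `K' ≤ K` letters, injective exponents, entry scales; the TropRow hypothesis descends
to `K'` classes by `tropRootLawAt_of_le_classes`); if `K' = 0` the determinant is constant (`octaveCount_pencilDet_zero_letters`); otherwise
perturb at precision `P = 2^{C(K'+⌊log₂m⌋²)}(n+1)` (R2: symmetric, `2^{m(P+⌊log₂m⌋+8)}`-conditioned letters, nonzero determinant), keep all but
`P` octaves up to the factor `3` (K1), count the perturbed pencil's octaves without any tropical input (R1), and close with `condBudget_arith`.
Nothing is asserted: the hypothesis K1 carries all open content (and is Ω-W-equivalent). [line «conditioning», val-idea-1 g3; this file] -/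
theorem octaveWeakLifting_of_octaveStability (hK1 : OctaveStability) : OctaveWeakLifting := by
  obtain ⟨C, hC⟩ := hK1
  refine ⟨C + 12, fun m K n hT d S hS => ?_⟩
  change octaveCount (pencilDet d S) ≤ _
  obtain ⟨K', hK', d', S', ρ, hd', hS', hρ, hsc, hdet⟩ := reducedForm m K d S hS
  rw [← hdet]
  have hT' : TropRootLawAt m K' n :=
    tropRootLawAt_of_le_classes hK' (fun d v ε n' θ p hε hθ hdom halt => hT d v ε n' θ p hε hθ hdom halt)
  rcases Nat.eq_zero_or_pos K' with hK0 | hK0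
  · subst hK0
    rw [octaveCount_pencilDet_zero_letters]
    exact Nat.zero_le _
  · set P := 2 ^ (C * (K' + Nat.log 2 m ^ 2)) * (n + 1) with hP
    obtain ⟨S'', hS''symm, hpert, hcond, hne⟩ := conditionedPerturbation m K' P d' S' ρ hK0 hd' hS' hρ hsc
    have hstab := hC m K' n hT' d' S' S'' ρ hd' hS' hS''symm hρ hsc hpert hne
    have hR1 := normEra_octaveBound m K' (m * (P + Nat.log 2 m + 8)) d' S'' hd' hcond
    calc octaveCount (pencilDet d' S')
        ≤ P + 3 * octaveCount (pencilDet d' S'') := hstab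
      _ ≤ P + 3 * ((2 * (m * (P + Nat.log 2 m + 8) + Nat.log 2 K' + 1) + 2) * (K' * K')) := by gcongr
      _ ≤ 2 ^ ((C + 12) * (K + Nat.log 2 m ^ 2)) * (n + 1) := condBudget_arith C m K K' n hK' hK0

/-- **the converse is trivial and `S'`-blind** (critic val-idea-crit-2, VERDICT #22): Ω-W gives K1 with the SAME constant, ignoring the
perturbation.  Hence K1 is the door Ω-W re-typed in perturbation form, not a weaker law. [critic #22; this file] -/
theorem octaveStability_of_octaveWeakLifting (h : OctaveWeakLifting) : OctaveStability := by
  obtain ⟨C, hC⟩ := h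
  refine ⟨C, fun m K n hT d S S' ρ _ hS _ _ _ _ _ => ?_⟩
  exact Nat.le_add_right_of_le (hC m K n (fun d v ε n' θ p hε hθ hdom halt => hT d v ε n' θ p hε hθ hdom halt) d S hS)

/-- **K1 ⟺ Ω-W** (⇒ through the landed rungs R0 · R1 · R2 with `C ↦ C + 12`; ⇐ trivial).  As statements the law stub of line
«conditioning» IS the octave door (stmt-ValiantsHypothesis-24457, `Iff.rfl`-equal to `OctaveWeakLifting` by `octaveWeakLifting_iff_glueShape`).
[this file + critic #22] -/
theorem octaveStability_iff_octaveWeakLifting : OctaveStability ↔ OctaveWeakLifting :=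
  ⟨octaveWeakLifting_of_octaveStability, octaveStability_of_octaveWeakLifting⟩

/-- **VP ≠ VNP ⟸ TropicalB + K1** (through `octaveStability_iff_octaveWeakLifting` / `octaveWeakLifting_of_octaveStability` and the landed glue
`valiant_of_tropicalB_of_octaveWeakLifting`; both hypotheses are OPEN — nothing is claimed). [this file] -/
theorem valiant_of_tropicalB_of_octaveStability (hT : TropicalB) (hK1 : OctaveStability) : _root_.ValiantsHypothesis :=
  valiant_of_tropicalB_of_octaveWeakLifting hT (octaveStability_iff_octaveWeakLifting.mp hK1)

/-! ### Dictionary with the other recorded doors (all hypotheses OPEN; pure composition) -/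

/-- **W ⇒ K1**: the crux `WeakLifting` (stmt-ValiantsHypothesis-19561) implies octave stability (`octaveWeakLifting_of_weakLifting` then the
trivial converse). [this file] -/
theorem octaveStability_of_weakLifting (h : WeakLifting) : OctaveStability :=
  octaveStability_of_octaveWeakLifting (octaveWeakLifting_of_weakLifting h)

/-- **tempered representability ⇒ K1** (the dictionary of memo `Cruxes/WeakLifting/Lines/octave-tempered.md` §4, now kernel-checked:
`octaveWeakLifting_of_temperedRepresentability` of `…OctaveTemperedGlue`, then the trivial converse). [this file] -/
theorem octaveStability_of_temperedRepresentability (h : TemperedRepresentability) : OctaveStability :=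
  octaveStability_of_octaveWeakLifting (octaveWeakLifting_of_temperedRepresentability h)

/-- **free-exponent tempered representability ⇒ K1** (`octaveWeakLifting_of_freeTemperedRepresentability`, then the trivial converse).
[this file] -/
theorem octaveStability_of_freeTemperedRepresentability (h : FreeTemperedRepresentability) : OctaveStability :=
  octaveStability_of_octaveWeakLifting (octaveWeakLifting_of_freeTemperedRepresentability h)

end Conditioning

end Summit.ValiantsHypothesis.ValiantsHypothesis.Theorems.KPlusLogSqLaw.Octave
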